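import Literature.Probability.Process.MatrixRenewalReward
import HarnessLib

/-!
# The second factorial moment of the piece count of a critical matrix renewal pair: `Q(m)_{ab}/((m+1)² D(m)_{ab}) → ν²` — the number of
# pieces per unit length has asymptotically vanishing variance (module «MATRIX-RENEWAL-PIECES-LLN», abstract half)

Topic `Literature/Probability/Process` (renewal theory; continues «MATRIX-RENEWAL-REWARD» `MatrixRenewalReward.lean` — for a `RenewalKernelPair` `K` with
`K.Critical L`: the reward pairs `RewardPair K` (`S = R + R∗D + M∗S`), the pointwise renewal–reward theorem `RewardPair.tendsto_S_div`
(`S(m)/(m+1) → L R̄ L`), the pieces pair (`R = M`, `S = G·M·G`: sequences counted with multiplicity = number of pieces) and the elementary renewal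
theorem `Critical.tendsto_pieces_div_D` (`N(m)_{ab}/((m+1)D(m)_{ab}) → ν := (Σ_c L_{oc}L_{co})/L_{oo}`); «MATRIX-RENEWAL-CONSTANT» (`Critical.L_mul_L_eq`
rank one, `Critical.L_mul_tsum_M`: `L M̂ = L`); `MatrixRenewalCoefficients.lean` (`cf`, `serG`, `serM`, `ren_right`, `tendsto_coeff`); the scalar
«convergent ∗ summable» lemma `Renewal.tendsto_sum_antidiagonal_mul` of `RenewalTheoremGeneral.lean`).  Lane «pcv-sawmu» (CriticalPhenomena venture),
a-p2 g24 — the abstract half of the strip's «RENEWAL-POINT-LLN» (concentration of the number of renewal vertices of a long critical bridge).  Sources of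
the TEMPLATE: W. Feller I (1968) XIII.3 (elementary renewal theorem), XIII.11 (cumulative processes: first AND second moments by repeated renewal
arguments); E. Seneta (1973) §6.2.  The arrangement (a second «factorial-moment» sequence `Q` tied to the pieces pair by `Q = M∗(Q + 2S)`, solved as
`Q = G·M·(2S)`, and an order-two weighted Cesàro lemma) is the lane's; nothing here is quoted.

## What is proved (namespace `Literature.Probability.Process.RenewalKernelPair`; `K.Critical L` in §2–§3)

* §1 ★ `tendsto_antidiagonal_mul_div_sq` — WEIGHTED CESÀRO PRODUCT (order two): `x_n → X`, `y_n/(n+1) → Y` ⇒ `(n+1)⁻² Σ_{i+j=n} x_i y_j → XY/2`.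
* §2 ★ `Critical.tendsto_cf_serG_mul_serM` — `(G∗M)(i)_{ac} → Σ_d L_{ad} M̄_{dc} = L_{ac}`.
* §3 `serG_mul_one_sub_serM` (`G(1 − I) = 1`); ★★ `Q_eq_conv` — if `Q(m) = Σ_{i+j=m} M(i)(Q(j) + 2S(j))` for a reward pair with `R = M` (the pieces pair),
  then `Q(m)_{ab} = Σ_{i+j=m} Σ_c (G∗M)(i)_{ac} · 2S(j)_{cb}` (`Q = G·M·2S` as power series); ★★★ `tendsto_Q_div_sq` — `Q(m)_{ab}/(m+1)² → (L³)_{ab}`;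
  `Critical.L_cube_eq` (rank one: `(L³)_{ab} = L_{ab}(tr L)²`, `ν = tr L`); ★★★★ `tendsto_Q_div_sq_D` —
  **`Q(m)_{ab}/((m+1)² D(m)_{ab}) → ν²`**, `ν = (Σ_c L_{oc}L_{co})/L_{oo}` the density of the elementary renewal theorem: the second factorial moment of
  (pieces)/(length) converges to the square of the first, for every pair of levels — whence the variance of the piece density of a sequence of total
  length `m` is `o(1)` and the piece density concentrates at `ν` (the user assembles Chebyshev from its explicit sums; done for the strip in
  `RandomPlanarGeometry/HexSAWStripBridgeRenewalPointLLN.lean`).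

Label: CLASSICAL TEMPLATE (second moments of renewal counts, Feller XIII) in the lane's matrix / pointwise ARRANGEMENT (own proof route; a-p2 g24,
2026-08-27).  NOT claimed: a central limit theorem, the exact second-order term of the variance (`σ² m`), periodic or null-recurrent pairs, rewards other
than the piece count (a reward version needs the second moment of the one-piece reward).
-/

noncomputable section

open Finset Filter Topology Matrix PowerSeries Literature.Analysis.Matrix

namespace Literature.Probability.Process

namespace RenewalKernelPair

variable {ι : Type*} [Fintype ι] [DecidableEq ι] {K : RenewalKernelPair ι} {L : ι → ι → ℝ}

/-! ### §1 A weighted Cesàro product lemma (order two) -/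

/-- **Weighted Cesàro product** (order two): if `x_n → X` and `y_n/(n+1) → Y` then `(n+1)⁻² Σ_{i+j=n} x_i y_j → X·Y/2`.
[cite: Feller1968, XIII.11 (second moments of cumulative processes: the same Tauberian bookkeeping); lane «pcv-sawmu» a-p2 g24 — plumbing] -/
theorem tendsto_antidiagonal_mul_div_sq {x y : ℕ → ℝ} {X Y : ℝ} (hx : Tendsto x atTop (𝓝 X))
    (hy : Tendsto (fun n : ℕ => y n / ((n : ℝ) + 1)) atTop (𝓝 Y)) :
    Tendsto (fun n : ℕ => (∑ p ∈ antidiagonal n, x p.1 * y p.2) / ((n : ℝ) + 1) ^ 2) atTop (𝓝 (X * Y / 2)) := by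
  -- notation: `b j = y j/(j+1) → Y`, bounded by `B`
  set b : ℕ → ℝ := fun j => y j / ((j : ℝ) + 1) with hb
  have hyb : ∀ j : ℕ, y j = ((j : ℝ) + 1) * b j := fun j => by
    rw [hb]; field_simp
  obtain ⟨Bu, hBu⟩ := hy.bddAbove_range
  obtain ⟨Bl, hBl⟩ := hy.bddBelow_range
  set B := max |Bu| |Bl| with hB
  have hbB : ∀ j, |b j| ≤ B := fun j => by
    rw [abs_le]
    constructor
    · have h1 := hBl ⟨j, rfl⟩
      have h2 : -B ≤ Bl := by have := neg_abs_le Bl; have := le_max_right |Bu| |Bl|; linarith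
      exact h2.trans h1
    · exact (hBu ⟨j, rfl⟩).trans ((le_abs_self Bu).trans (le_max_left _ _))
  have hB0 : 0 ≤ B := (abs_nonneg _).trans (le_max_left _ _)
  -- Cesàro means of `|x − X|` and `|b − Y|`
  have hcx : Tendsto (fun n : ℕ => (((n + 1 : ℕ) : ℝ)⁻¹) * ∑ i ∈ range (n + 1), |x i - X|) atTop (𝓝 0) := by
    have h0 : Tendsto (fun i => |x i - X|) atTop (𝓝 0) := by
      have h1 := (hx.sub_const X).abs
      rwa [sub_self, abs_zero] at h1
    exact h0.cesaro.comp (tendsto_add_atTop_nat 1)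
  have hcb : Tendsto (fun n : ℕ => (((n + 1 : ℕ) : ℝ)⁻¹) * ∑ i ∈ range (n + 1), |b i - Y|) atTop (𝓝 0) := by
    have h0 : Tendsto (fun i => |b i - Y|) atTop (𝓝 0) := by
      have h1 := (hy.sub_const Y).abs
      rwa [sub_self, abs_zero] at h1
    exact h0.cesaro.comp (tendsto_add_atTop_nat 1)
  -- the main term `(n+2)/(2(n+1)) → 1/2`
  have hmain : Tendsto (fun n : ℕ => ((n : ℝ) + 2) / (2 * ((n : ℝ) + 1))) atTop (𝓝 (1 / 2)) := by
    have h1 : Tendsto (fun n : ℕ => 1 / (2 * ((n : ℝ) + 1))) atTop (𝓝 0) := by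
      have : Tendsto (fun n : ℕ => 2 * ((n : ℝ) + 1)) atTop atTop :=
        Tendsto.const_mul_atTop two_pos (tendsto_natCast_atTop_atTop.atTop_add tendsto_const_nhds)
      exact tendsto_const_nhds.div_atTop this
    have h2 : Tendsto (fun n : ℕ => 1 / 2 + 1 / (2 * ((n : ℝ) + 1))) atTop (𝓝 (1 / 2 + 0)) := tendsto_const_nhds.add h1
    rw [add_zero] at h2
    refine h2.congr fun n => ?_
    field_simp
    ring
  -- decomposition: `Σ x_i y_j = XY Σ (j+1) + X Σ (j+1)(b_j − Y) + Σ (x_i − X) y_j`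
  have hdec : ∀ n : ℕ, ∑ p ∈ antidiagonal n, x p.1 * y p.2 =
      X * Y * (((n : ℝ) + 1) * ((n : ℝ) + 2) / 2) + (X * ∑ p ∈ antidiagonal n, ((p.2 : ℝ) + 1) * (b p.2 - Y) +
        ∑ p ∈ antidiagonal n, (x p.1 - X) * y p.2) := by
    intro n
    have hsum1 : ∑ p ∈ antidiagonal n, ((p.2 : ℝ) + 1) = ((n : ℝ) + 1) * ((n : ℝ) + 2) / 2 := by
      rw [← Finset.Nat.sum_antidiagonal_swap, Finset.Nat.sum_antidiagonal_eq_sum_range_succ_mk]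
      simp only [Prod.snd_swap]
      have : ∀ m : ℕ, ∑ i ∈ range (m + 1), ((i : ℝ) + 1) = ((m : ℝ) + 1) * ((m : ℝ) + 2) / 2 := by
        intro m
        induction m with
        | zero => norm_num
        | succ m ih => rw [Finset.sum_range_succ, ih]; push_cast; ring
      exact this n
    rw [← hsum1, mul_sum, mul_sum, ← sum_add_distrib, ← sum_add_distrib]
    refine sum_congr rfl fun p _ => ?_
    rw [hyb p.2]
    ring
  -- the bound
  have hbound : ∀ n : ℕ, |(∑ p ∈ antidiagonal n, x p.1 * y p.2) / ((n : ℝ) + 1) ^ 2 - X * Y / 2| ≤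
      |X * Y| * |((n : ℝ) + 2) / (2 * ((n : ℝ) + 1)) - 1 / 2| +
        (|X| * ((((n + 1 : ℕ) : ℝ)⁻¹) * ∑ i ∈ range (n + 1), |b i - Y|) +
        B * ((((n + 1 : ℕ) : ℝ)⁻¹) * ∑ i ∈ range (n + 1), |x i - X|)) := by
    intro n
    have hn : (0 : ℝ) < (n : ℝ) + 1 := by positivity
    have hn2 : (0 : ℝ) < ((n : ℝ) + 1) ^ 2 := by positivity
    have hcast : (((n + 1 : ℕ) : ℝ)⁻¹) = 1 / ((n : ℝ) + 1) := by push_cast; rw [one_div]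
    rw [hdec n, hcast]
    have e : (X * Y * (((n : ℝ) + 1) * ((n : ℝ) + 2) / 2) + (X * ∑ p ∈ antidiagonal n, ((p.2 : ℝ) + 1) * (b p.2 - Y) +
        ∑ p ∈ antidiagonal n, (x p.1 - X) * y p.2)) / ((n : ℝ) + 1) ^ 2 - X * Y / 2 =
        X * Y * (((n : ℝ) + 2) / (2 * ((n : ℝ) + 1)) - 1 / 2) +
          (X * (∑ p ∈ antidiagonal n, ((p.2 : ℝ) + 1) * (b p.2 - Y)) / ((n : ℝ) + 1) ^ 2 +
            (∑ p ∈ antidiagonal n, (x p.1 - X) * y p.2) / ((n : ℝ) + 1) ^ 2) := by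
      field_simp
      ring
    rw [e]
    refine (abs_add_le _ _).trans (add_le_add ?_ ((abs_add_le _ _).trans (add_le_add ?_ ?_)))
    · rw [abs_mul]
    · rw [abs_div, abs_mul, abs_of_pos hn2, mul_div_assoc]
      refine mul_le_mul_of_nonneg_left ?_ (abs_nonneg _)
      rw [div_le_iff₀ hn2]
      calc |∑ p ∈ antidiagonal n, ((p.2 : ℝ) + 1) * (b p.2 - Y)|
          ≤ ∑ p ∈ antidiagonal n, ((n : ℝ) + 1) * |b p.2 - Y| := by
            refine (abs_sum_le_sum_abs _ _).trans (sum_le_sum fun p hp => ?_)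
            have hp2 : (p.2 : ℝ) ≤ n := by
              have := Finset.HasAntidiagonal.mem_antidiagonal.1 hp
              exact_mod_cast (show p.2 ≤ n by omega)
            rw [abs_mul, abs_of_nonneg (by positivity : (0 : ℝ) ≤ (p.2 : ℝ) + 1)]
            exact mul_le_mul_of_nonneg_right (by linarith) (abs_nonneg _)
        _ = ((n : ℝ) + 1) * ∑ i ∈ range (n + 1), |b i - Y| := by
            rw [← mul_sum, ← Finset.Nat.sum_antidiagonal_swap, Finset.Nat.sum_antidiagonal_eq_sum_range_succ_mk]
            simp
        _ = 1 / ((n : ℝ) + 1) * (∑ i ∈ range (n + 1), |b i - Y|) * ((n : ℝ) + 1) ^ 2 := by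
            field_simp
    · rw [abs_div, abs_of_pos hn2, div_le_iff₀ hn2]
      calc |∑ p ∈ antidiagonal n, (x p.1 - X) * y p.2|
          ≤ ∑ p ∈ antidiagonal n, |x p.1 - X| * (((n : ℝ) + 1) * B) := by
            refine (abs_sum_le_sum_abs _ _).trans (sum_le_sum fun p hp => ?_)
            rw [abs_mul]
            refine mul_le_mul_of_nonneg_left ?_ (abs_nonneg _)
            have hp2 : (p.2 : ℝ) ≤ n := by
              have := Finset.HasAntidiagonal.mem_antidiagonal.1 hp
              exact_mod_cast (show p.2 ≤ n by omega)
            rw [hyb p.2, abs_mul, abs_of_nonneg (by positivity : (0 : ℝ) ≤ (p.2 : ℝ) + 1)]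
            exact mul_le_mul (by linarith) (hbB p.2) (abs_nonneg _) (by positivity)
        _ = (((n : ℝ) + 1) * B) * ∑ i ∈ range (n + 1), |x i - X| := by
            rw [← sum_mul, mul_comm, Finset.Nat.sum_antidiagonal_eq_sum_range_succ_mk]
        _ = B * (1 / ((n : ℝ) + 1) * ∑ i ∈ range (n + 1), |x i - X|) * ((n : ℝ) + 1) ^ 2 := by
            field_simp
  have hlim : Tendsto (fun n : ℕ => |X * Y| * |((n : ℝ) + 2) / (2 * ((n : ℝ) + 1)) - 1 / 2| +
      (|X| * ((((n + 1 : ℕ) : ℝ)⁻¹) * ∑ i ∈ range (n + 1), |b i - Y|) +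
      B * ((((n + 1 : ℕ) : ℝ)⁻¹) * ∑ i ∈ range (n + 1), |x i - X|))) atTop (𝓝 (|X * Y| * 0 + (|X| * 0 + B * 0))) := by
    have h1 : Tendsto (fun n : ℕ => |((n : ℝ) + 2) / (2 * ((n : ℝ) + 1)) - 1 / 2|) atTop (𝓝 0) := by
      have := (hmain.sub_const (1 / 2 : ℝ)).abs
      rwa [sub_self, abs_zero] at this
    exact (h1.const_mul _).add ((hcb.const_mul _).add (hcx.const_mul _))
  rw [mul_zero, mul_zero, mul_zero, add_zero, add_zero] at hlim
  rw [Metric.tendsto_atTop]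
  intro ε hε
  obtain ⟨N, hN⟩ := Metric.tendsto_atTop.1 hlim ε hε
  refine ⟨N, fun n hn => ?_⟩
  rw [Real.dist_eq]
  have h1 := hN n hn
  rw [Real.dist_eq, sub_zero] at h1
  exact lt_of_le_of_lt ((hbound n).trans (le_abs_self _)) h1

/-! ### §2 `(G ∗ M)(i) → L M̄ = L`: the one-piece kernel seen from a long prefix -/

/-- `Σ_{k+j=i} Σ_d G(k)_{ad} M(j)_{dc} → Σ_d L_{ad} M̄_{dc} = L_{ac}` under `K.Critical L` («convergent ∗ summable», then `L M̂ = L`).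
[cite: Feller1968, XIII.3, XIII.11; Seneta1973, §6.2; lane «pcv-sawmu» a-p2 g24] -/
theorem Critical.tendsto_cf_serG_mul_serM (h : K.Critical L) (a c : ι) :
    Tendsto (fun i : ℕ => cf i (K.serG * K.serM) a c) atTop (𝓝 (L a c)) := by
  have hlim : Tendsto (fun i : ℕ => ∑ d, ∑ q ∈ antidiagonal i, K.M q.1 d c * K.G q.2 a d) atTop
      (𝓝 (∑ d, (∑' j : ℕ, K.M j d c) * L a d)) := by
    refine tendsto_finsetSum _ fun d _ => ?_
    have hG := RewardPair.tendsto_G_of_critical h a d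
    obtain ⟨B, hB⟩ := hG.bddAbove_range
    have hGB : ∀ n, |K.G n a d| ≤ B := fun n => by rw [abs_of_nonneg (K.G_nonneg n a d)]; exact hB ⟨n, rfl⟩
    exact Renewal.tendsto_sum_antidiagonal_mul (g := fun j => K.M j d c) (u := fun n => K.G n a d)
      (fun j => K.M_nonneg j d c) (h.summable_M d c) hGB hG
  have hval : ∑ d, (∑' j : ℕ, K.M j d c) * L a d = L a c := by
    rw [← h.L_mul_tsum_M a c]
    exact sum_congr rfl fun d _ => mul_comm _ _
  rw [hval] at hlim
  refine hlim.congr fun i => ?_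
  rw [cf_mul, sum_comm, ← Finset.Nat.sum_antidiagonal_swap]
  refine sum_congr rfl fun q _ => sum_congr rfl fun d _ => ?_
  simp only [Prod.fst_swap, Prod.snd_swap, cf_serM]
  rw [mul_comm]
  rfl

/-! ### §3 The second factorial moment of the piece count: `Q = 2·G M G M G`, `Q(m)/(m+1)² → L³` -/

/-- The right renewal identity as an inverse: `G · (1 − I) = 1` in `PowerSeries (Matrix ι ι ℝ)` (plumbing; the tree proves it inside
`RewardPair.serS_eq_sandwich`). [cite: Feller1968, XIII.3 (U = 1 + FU); lane plumbing] -/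
theorem serG_mul_one_sub_serM (K : RenewalKernelPair ι) : K.serG * (1 - K.serM) = 1 := by
  have hright : K.serG = 1 + K.serG * K.serM := by
    refine PowerSeries.ext fun m => ?_
    rw [map_add, PowerSeries.coeff_mul, PowerSeries.coeff_one]
    have hG : ∀ j, coeff j K.serG = (if j = 0 then (1 : Matrix ι ι ℝ) else 0) + K.D j := fun j => by
      rw [RenewalKernelPair.serG, map_add, PowerSeries.coeff_one, coeff_mk]
    simp only [hG, coeff_serM, add_mul, sum_add_distrib]
    have h1 : ∑ p ∈ antidiagonal m, (if p.1 = 0 then (1 : Matrix ι ι ℝ) else 0) * K.M p.2 = K.M m := by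
      rw [Finset.sum_eq_single (0, m)]
      · simp
      · intro p hp hne
        have hp' := HasAntidiagonal.mem_antidiagonal.mp hp
        have : p.1 ≠ 0 := fun h0 => hne (by ext <;> simp <;> omega)
        simp [this]
      · intro h; exact absurd (HasAntidiagonal.mem_antidiagonal.mpr (by simp)) h
    rw [h1, K.ren_right m]
  rw [mul_sub, mul_one, sub_eq_iff_eq_add', add_comm]
  exact hright

/-- ★★ **THE `Q`-RECURSION SOLVED**: if `Q(m) = Σ_{i+j=m} M(i)·(Q(j) + 2S(j))` where `(M, S)` is the PIECES reward pair (`R = M`, `S = G M G` counts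
sequences with multiplicity = number of pieces), then `Q = G·M·(2S)` as power series, i.e. `Q(m)_{ab} = Σ_{i+j=m} Σ_c (G M)(i)_{ac} · 2S(j)_{cb}`.
(For the strip: `Q(m)_{ab} = Σ_{bridges, m steps} n(n−1)·weight` with `n` = number of pieces: `(n+1)n = n(n−1) + 2n` is the first-piece split.)
[cite: Feller1968, XIII.11 (higher moments of cumulative processes via repeated renewal arguments); lane «pcv-sawmu» a-p2 g24 — own arrangement] -/
theorem Q_eq_conv (W : RewardPair K) (Q : ℕ → Matrix ι ι ℝ)
    (renQ : ∀ m, Q m = ∑ p ∈ antidiagonal m, K.M p.1 * (Q p.2 + (2 : ℝ) • W.S p.2)) (m : ℕ) (a b : ι) :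
    Q m a b = ∑ p ∈ antidiagonal m, ∑ c, cf p.1 (K.serG * K.serM) a c * (2 * W.S p.2 c b) := by
  set S' : ℕ → Matrix ι ι ℝ := fun m => (2 : ℝ) • W.S m with hS'
  have hser : PowerSeries.mk Q = K.serM * (PowerSeries.mk Q + PowerSeries.mk S') := by
    refine PowerSeries.ext fun m => ?_
    rw [coeff_mk, PowerSeries.coeff_mul, renQ m]
    refine sum_congr rfl fun p _ => ?_
    rw [coeff_serM, map_add, coeff_mk, coeff_mk]
  have h1 : (1 - K.serM) * PowerSeries.mk Q = K.serM * PowerSeries.mk S' := by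
    rw [sub_mul, one_mul]
    nth_rewrite 1 [hser]
    rw [mul_add]
    abel
  have hQ : PowerSeries.mk Q = K.serG * K.serM * PowerSeries.mk S' := by
    calc PowerSeries.mk Q = (K.serG * (1 - K.serM)) * PowerSeries.mk Q := by rw [serG_mul_one_sub_serM, one_mul]
      _ = K.serG * ((1 - K.serM) * PowerSeries.mk Q) := by rw [mul_assoc]
      _ = K.serG * (K.serM * PowerSeries.mk S') := by rw [h1]
      _ = K.serG * K.serM * PowerSeries.mk S' := by rw [mul_assoc]
  have h := congr_arg (fun F => cf m F a b) hQ
  simp only [cf_mk] at h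
  rw [h, cf_mul]
  refine sum_congr rfl fun p _ => sum_congr rfl fun c _ => ?_
  rw [cf_mk, hS']
  simp only [Matrix.smul_apply, smul_eq_mul]

/-- ★★★ **SECOND FACTORIAL MOMENT, POINTWISE**: under `K.Critical L`, with `(M, S)` the pieces reward pair and `Q` as in `Q_eq_conv`,
`Q(m)_{ab}/(m+1)² ⟶ Σ_c L_{ac} Σ_d L_{cd} L_{db} = (L³)_{ab}`
— weighted Cesàro product of `(G M)(i) → L` and `2S(j)/(j+1) → 2L²`. [cite: Feller1968, XIII.11; Seneta1973, §6.2; lane «pcv-sawmu» a-p2 g24 — own arrangement] -/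
theorem tendsto_Q_div_sq (h : K.Critical L) (W : RewardPair K) (hR : ∀ j, W.R j = K.M j) (Q : ℕ → Matrix ι ι ℝ)
    (renQ : ∀ m, Q m = ∑ p ∈ antidiagonal m, K.M p.1 * (Q p.2 + (2 : ℝ) • W.S p.2)) (a b : ι) :
    Tendsto (fun m : ℕ => Q m a b / ((m : ℝ) + 1) ^ 2) atTop (𝓝 (∑ c, L a c * ∑ d, L c d * L d b)) := by
  -- `2 S(j)_{cb}/(j+1) → 2 (L²)_{cb}`
  have hS : ∀ c, Tendsto (fun j : ℕ => 2 * W.S j c b / ((j : ℝ) + 1)) atTop (𝓝 (2 * ∑ d, L c d * L d b)) := fun c => by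
    have h1 := W.tendsto_S_div h c b
    have hval : ∑ d, (∑ e, L c e * ∑' j : ℕ, W.R j e d) * L d b = ∑ d, L c d * L d b := by
      refine sum_congr rfl fun d _ => ?_
      congr 1
      simp_rw [hR]
      exact h.L_mul_tsum_M c d
    rw [hval] at h1
    have := h1.const_mul 2
    refine this.congr fun j => ?_
    ring
  have hsum : Tendsto (fun m : ℕ => ∑ c, (∑ p ∈ antidiagonal m, cf p.1 (K.serG * K.serM) a c * (2 * W.S p.2 c b)) / ((m : ℝ) + 1) ^ 2)
      atTop (𝓝 (∑ c, L a c * (2 * ∑ d, L c d * L d b) / 2)) :=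
    tendsto_finsetSum _ fun c _ =>
      tendsto_antidiagonal_mul_div_sq (x := fun i : ℕ => cf i (K.serG * K.serM) a c) (y := fun j : ℕ => 2 * W.S j c b)
        (h.tendsto_cf_serG_mul_serM a c) (hS c)
  have hval : ∑ c, L a c * (2 * ∑ d, L c d * L d b) / 2 = ∑ c, L a c * ∑ d, L c d * L d b :=
    sum_congr rfl fun c _ => by ring
  rw [hval] at hsum
  refine hsum.congr fun m => ?_
  rw [Q_eq_conv W Q renQ m a b, Finset.sum_div]
  simp only [Finset.sum_div]
  exact Finset.sum_comm

/-- Rank-one algebra: `(L³)_{ab} = L_{ab} · (Σ_c L_{cc})²` and `(Σ_c L_{oc}L_{co})/L_{oo} = Σ_c L_{cc}` (plumbing, from `Critical.L_mul_L_eq`).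
[cite: Seneta1973, §1.4; lane plumbing a-p2 g24] -/
theorem Critical.L_cube_eq (h : K.Critical L) (o a b : ι) :
    (∑ c, L a c * ∑ d, L c d * L d b) = L a b * (∑ c, L c c) ^ 2 ∧ (∑ c, L o c * L c o) / L o o = ∑ c, L c c := by
  constructor
  · have : ∀ c d, L a c * (L c d * L d b) = L a b * (L c c * L d d) := fun c d => by
      have h1 := h.L_mul_L_eq a c c d   -- L a c * L c d = L a d * L c c
      have h2 := h.L_mul_L_eq a d d b   -- L a d * L d b = L a b * L d d
      calc L a c * (L c d * L d b) = (L a c * L c d) * L d b := by ring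
        _ = L a d * L c c * L d b := by rw [h1]
        _ = (L a d * L d b) * L c c := by ring
        _ = L a b * L d d * L c c := by rw [h2]
        _ = L a b * (L c c * L d d) := by ring
    simp_rw [mul_sum, this]
    simp_rw [← mul_sum]
    rw [sq, sum_mul_sum]
    simp_rw [mul_sum]
  · rw [div_eq_iff (h.pos o o).ne', sum_mul]
    refine sum_congr rfl fun c _ => ?_
    have := h.L_mul_L_eq o c c o
    linarith

/-- ★★★★ **`Q(m)_{ab}/((m+1)² D(m)_{ab}) → ν²`** with `ν = (Σ_c L_{oc}L_{co})/L_{oo}` the pieces-per-length density of the elementary renewal theorem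
(`Critical.tendsto_pieces_div_D`): the SECOND factorial moment of (pieces)/(length) converges to the SQUARE of the first — so the variance of the
piece density vanishes in the limit (concentration / weak law, assembled by the user from the explicit sums). [cite: Feller1968, XIII.3, XIII.11; Seneta1973, §6.2; lane «pcv-sawmu» a-p2 g24 — own result] -/
theorem tendsto_Q_div_sq_D (h : K.Critical L) (W : RewardPair K) (hR : ∀ j, W.R j = K.M j) (Q : ℕ → Matrix ι ι ℝ)
    (renQ : ∀ m, Q m = ∑ p ∈ antidiagonal m, K.M p.1 * (Q p.2 + (2 : ℝ) • W.S p.2)) (o a b : ι) :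
    Tendsto (fun m : ℕ => Q m a b / (((m : ℝ) + 1) ^ 2 * K.D m a b)) atTop (𝓝 (((∑ c, L o c * L c o) / L o o) ^ 2)) := by
  have h1 := tendsto_Q_div_sq h W hR Q renQ a b
  rw [(h.L_cube_eq o a b).1] at h1
  have h2 := K.tendsto_coeff h a b
  have hq := h1.div h2 (h.pos a b).ne'
  rw [mul_div_cancel_left₀ _ (h.pos a b).ne'] at hq
  rw [(h.L_cube_eq o a b).2]
  refine hq.congr fun m => ?_
  simp only [Pi.div_apply]
  rw [div_div]

end RenewalKernelPair

end Literature.Probability.Process
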